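import Literature.NumberTheory.Rogawski1990.ExplicitFactorProductFormula
import Literature.NumberTheory.Rogawski1990.ExplicitFactorKappaAlmostEverywhereOne
import HarnessLib

/-!
# The named fact `GlobalTransferFactorProductFormula L H′ Δ_∞` HOLDS at print's archimedean factor `Δ‴_∞`: Rogawski's explicit collection
# `(Δ‴_v)_v` is non-degenerate, almost everywhere trivial, and satisfies the product formula with `Δ‴_∞`

Topic `NumberTheory/Rogawski1990`; namespace `Literature.NumberTheory.Rogawski1990`.  THEOREMS ONLY (no definition, no named fact, no instance, no notation,
no `sorry`; net debt 0).  Cell `pub/hodgecm-mathlib`, F0∕P3a, topic T6 #72 side.  ★ `GlobalTransferFactorProductFormula L H′ Δ_∞` (`GlobalTransferFactor` §4,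
A-p06 (g18)) is the tree's NAMED FACT «there is a global collection `Δ = (Δ_v)_v` of local transfer factors, each non-degenerate, almost everywhere trivial on
every matching pair, whose adelic product with `Δ_∞` is `1` on rational matching `G`-regular pairs» [Rogawski1990 §4.3 pp. 43–44, §14.3 pp. 233–234, §14.6
pp. 242–243; LanglandsShelstad1987 §6.4] — a HYPOTHESIS of the engine line, «nothing in the tree proves it».  For `Δ_∞ := Δ‴_∞` (★ `archCanonicalDelta`,
the `c(H′)`-normalised explicit factor `τ · D_{G∕H} · Π_w sgn Re tr(P_wᴴ w(H′) P_w)`) it is now a THEOREM, with the EXPLICIT witness `Δ := Δ‴ = ` ★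
`finExplicitCollection` (N1f, typ-T6b) made unconditional by ★ `finExplicitDelta_conj_left_all` ∕ `finExplicitDelta_conj_right_all` (p08 ∕ p01): the three
conjuncts are ★ `isLocalNondegenerate_finExplicitCollection` (N2f, B-p12), ★ `isAlmostEverywhereTrivial_finExplicitCollection_canonical` (N3, A-p16 ∕ p01) and
★ `satisfiesProductFormula_finExplicitCollection` (N4, p05).  Hypotheses: `H′` `c`-hermitian with unit determinant and anisotropic on `L³`; `μ` ANY Hecke
character of `L` (print's `μ` is the one with `μ|_{𝔸_{L⁺}^×} = ω_{L∕L⁺}`; the three properties do not use that).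

* **`globalTransferFactorProductFormula_holds_explicit`** — `GlobalTransferFactorProductFormula L H′ (fun a b => archCanonicalDelta L H′ a μ b)`;
  `…_holds_explicit'` — the same at `(archCanonicalTransferFactor L H′ μ).Δ` (definitionally equal spelling used by the #77 pay-down lines).

HONEST LABEL: HC_CM is proved only modulo the printed citations (named inputs remaining 2) until rung 0 closes.  This file discharges ONE auxiliary named fact
of the tree at the explicit factor; the local transfers (N6 [LS₂]) and the unit fundamental lemma (N7 [BR₁]) of the joint fact ★
`GlobalTransferWithFundamentalLemma` remain print's citations.

## References
* [Rogawski1990] J. D. Rogawski, *Automorphic Representations of Unitary Groups in Three Variables*, Ann. of Math. Stud. 123 (1990), §4.3 (4.3.3) pp. 43–44,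
  §4.9 p. 55, §14.3 pp. 233–234, §14.6 pp. 242–243.
* [LanglandsShelstad1987] R. P. Langlands, D. Shelstad, *On the definition of transfer factors*, Math. Ann. 278 (1987), §6.4 Thm. 6.4.A, Cor. 6.4.B.
-/

set_option autoImplicit false

noncomputable section

open NumberField IsDedekindDomain
open Literature.NumberTheory.GaloisRepresentations
open Literature.AlgebraicGeometry.ShimuraVarieties (hermForm)

namespace Literature.NumberTheory.Rogawski1990

open Literature.NumberTheory.Automorphic

variable (L : Type) [Field L] [NumberField L] [IsCMField L] (H' : Matrix (Fin 3) (Fin 3) L) (μ : HeckeCharacter L)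

open scoped Classical in
/-- **THE GLOBAL TRANSFER-FACTOR PRODUCT-FORMULA FACT HOLDS AT `Δ‴_∞`**: for a `c`-hermitian anisotropic `H′` with unit determinant and any Hecke character `μ` of the
CM field `L`, Rogawski's explicit finite collection `Δ‴` witnesses ★ `GlobalTransferFactorProductFormula L H′ Δ‴_∞` — non-degenerate at every finite place,
almost everywhere trivial on matching pairs, product formula on rational matching `G`-regular pairs.
[cite: Rogawski1990, §4.3 (4.3.3) pp. 43–44; §14.6 pp. 242–243] [cite: LanglandsShelstad1987, §6.4 Thm. 6.4.A] -/
theorem globalTransferFactorProductFormula_holds_explicit (hherm : (H'.map (cmConjRingHom L)).transpose = H') (hdet : IsUnit H'.det)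
    (hanis : ∀ x : Fin 3 → L, hermForm (cmConjRingHom L) H' x x = 0 → x = 0) :
    GlobalTransferFactorProductFormula L H' (fun a b => archCanonicalDelta L H' a μ b) :=
  ⟨finExplicitCollection L H' μ (finExplicitDelta_conj_left_all L H' μ) (finExplicitDelta_conj_right_all L H' μ),
    isLocalNondegenerate_finExplicitCollection L H' μ _ _,
    isAlmostEverywhereTrivial_finExplicitCollection_canonical L H' hherm hdet μ,
    satisfiesProductFormula_finExplicitCollection L H' μ hherm hanis _ _⟩

open scoped Classical in
/-- The same at the ★ `ArchTransferFactor` spelling `(archCanonicalTransferFactor L H′ μ).Δ` of the #77 pay-down lines (definitionally `Δ‴_∞`).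
[cite: Rogawski1990, §14.6 pp. 242–243] [cite: LanglandsShelstad1987, §6.4 Thm. 6.4.A] -/
theorem globalTransferFactorProductFormula_holds_explicit' (hherm : (H'.map (cmConjRingHom L)).transpose = H') (hdet : IsUnit H'.det)
    (hanis : ∀ x : Fin 3 → L, hermForm (cmConjRingHom L) H' x x = 0 → x = 0) :
    GlobalTransferFactorProductFormula L H' (archCanonicalTransferFactor L H' μ).Δ :=
  globalTransferFactorProductFormula_holds_explicit L H' μ hherm hdet hanis

end Literature.NumberTheory.Rogawski1990
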